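import Summits.BirchSwinnertonDyer.BirchSwinnertonDyer.Theorems.Rank2ObservatoryMinimalCert
import Summits.BirchSwinnertonDyer.BirchSwinnertonDyer.Theorems.Rank2ObservatoryRank3MinCerts1
import Summits.BirchSwinnertonDyer.BirchSwinnertonDyer.Theorems.Rank2ObservatoryRank3MinCerts2
import Summits.BirchSwinnertonDyer.BirchSwinnertonDyer.Theorems.Rank2ObservatoryRank3MinCerts3
import Summits.BirchSwinnertonDyer.BirchSwinnertonDyer.Theorems.Rank2ObservatoryRank3MinCerts4
import HarnessLib

/-!
# BSD rank ≥ 2 observatory (`b2b-bsdr2`): the rank-3 census — GLOBAL MINIMALITY for the `1420` rows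
# without a root-number certificate (kernel, one pass; no named fact)

HONEST FRAMING: per-curve certified theorems and census instruments; no claim on BSD in rank ≥ 2.

The four DATA chunks `Rank2ObservatoryRank3MinCerts1–4` list `(row index, certificate)` for the
`1420` rows of `rank3Table` that have NO root-number certificate (`none` in `rank3RNCerts`: additive
reduction at `3`) but satisfy Silverman's criterion at every prime. Here the kernel decides, in ONE
pass over the `9487`-row table, that every listed certificate passes `RNCert.minCheck` on its row
(`rank3Table_minPosCheck`), that the listed indices are strictly increasing (`rank3MinCerts_sorted`)
and all point at `none` entries of `rank3RNCerts` (`rank3MinCerts_uncovered`) — so these `1420` rows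
are disjoint from the `7143` rows of `rank3Table_minCount`: Cremona's equation is a global minimal
model, as a theorem with no hypothesis, for `7143 + 1420 = 8563` of the `9487` rank-3 rows (the
remaining `924` fail the simple criterion at `2` or `3`; Kraus-type conditions would be needed).

* `rank3MinCerts`, `rank3MinCerts_length = 1420`, `rank3Table_minPosCheck`, `rank3MinCerts_sorted`,
  `posNone` / `rank3MinCerts_uncovered` (kernel);
* `Rank3Row.minCertified_of_mem_minCerts`, `Rank3Row.isGloballyMinimal_of_mem_minCerts`;
* the headline for these rows is `Rank3Row.rank3_lderiv_eq_zero_kernel_m` (`Rank2ObservatoryMinimalCert`).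

Cross-checks outside the proof: `gen_min_certs.py` (certificate generator) and `minimal_check.py`
(criterion straight from the a-invariants: `8563` rows pass, `7143` certified + `1420` here).
References: Silverman *AEC* VII.1 Rem. 1.1 [SilvermanAEC2009]; Cremona 1997 [CremonaAlgorithms1997].
-/

set_option linter.dupNamespace false
set_option autoImplicit false

namespace Summit.BirchSwinnertonDyer.BirchSwinnertonDyer.Rank2Observatory

open RootNumber

/-- All `1420` minimality-only certificates `(row index, certificate)`, indices increasing.
[cite: SilvermanAEC2009, VII.1 Remark 1.1] -/
def rank3MinCerts : List (ℕ × RNCert) :=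
  rank3MinCerts1 ++ rank3MinCerts2 ++ rank3MinCerts3 ++ rank3MinCerts4

/-- `1420` pairs (kernel). [cite: CremonaAlgorithms1997, Tables] -/
theorem rank3MinCerts_length : rank3MinCerts.length = 1420 := by
  decide +kernel

/-- **KERNEL CHECK (one pass over the table)**: every listed certificate passes `minCheck` on its row.
[cite: SilvermanAEC2009, VII.1 Remark 1.1] -/
theorem rank3Table_minPosCheck : posCheck rank3Table 0 rank3MinCerts = true := by
  decide +kernel

/-- Strictly increasing list of naturals (Bool, kernel-friendly). [folklore] -/
def sortedLT : List ℕ → Bool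
  | a :: b :: rest => decide (a < b) && sortedLT (b :: rest)
  | _ => true

/-- The listed row indices are strictly increasing (kernel): the `1420` rows are distinct. [folklore] -/
theorem rank3MinCerts_sorted : sortedLT (rank3MinCerts.map Prod.fst) = true := by
  decide +kernel

/-- One-pass check that the listed (increasing) indices all point at `none` entries of an aligned
option list. [folklore] -/
def posNone : List (Option RNCert) → ℕ → List ℕ → Bool
  | _, _, [] => true
  | [], _, _ :: _ => false
  | o :: os, n, i :: rest =>
      if i = n then o.isNone && posNone os (n + 1) rest else posNone os (n + 1) (i :: rest)

/-- What a passing `posNone` says about each listed index. [folklore] -/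
theorem isNone_of_posNone :
    ∀ (os : List (Option RNCert)) (n : ℕ) (is : List ℕ), posNone os n is = true →
      ∀ i ∈ is, n ≤ i ∧ os[i - n]? = some none
  | _, _, [], _, i, hm => by simp at hm
  | [], _, _ :: _, h, _, _ => by simp [posNone] at h
  | o :: os, n, j :: rest, h, i, hm => by
    by_cases hj : j = n
    · subst hj
      simp only [posNone, ↓reduceIte, Bool.and_eq_true, Option.isNone_iff_eq_none] at h
      rcases List.mem_cons.mp hm with rfl | hm'
      · exact ⟨le_rfl, by simp [h.1]⟩
      · obtain ⟨hle, ho⟩ := isNone_of_posNone os (j + 1) rest h.2 i hm'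
        refine ⟨by omega, ?_⟩
        rw [show i - j = (i - (j + 1)) + 1 by omega, List.getElem?_cons_succ]
        exact ho
    · simp only [posNone, hj, ↓reduceIte] at h
      obtain ⟨hle, ho⟩ := isNone_of_posNone os (n + 1) (j :: rest) h i hm
      refine ⟨by omega, ?_⟩
      rw [show i - n = (i - (n + 1)) + 1 by omega, List.getElem?_cons_succ]
      exact ho

/-- **The `1420` listed rows carry NO root-number certificate** (`none` in `rank3RNCerts`; kernel, one
pass): they are disjoint from the `7143` rows counted by `rank3Table_minCount`.
[cite: CremonaAlgorithms1997, Tables] -/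
theorem rank3MinCerts_uncovered : posNone rank3RNCerts 0 (rank3MinCerts.map Prod.fst) = true := by
  decide +kernel

/-- Index form of `rank3MinCerts_uncovered`. [folklore] -/
theorem rank3RNCerts_eq_none_of_mem_minCerts {i : ℕ} {c : RNCert} (hm : (i, c) ∈ rank3MinCerts) :
    rank3RNCerts[i]? = some none := by
  have h := isNone_of_posNone _ 0 _ rank3MinCerts_uncovered i (List.mem_map.mpr ⟨(i, c), hm, rfl⟩)
  simpa using h.2

/-- A listed pair certifies its row (minimality-only form). [cite: SilvermanAEC2009, VII.1 Remark 1.1] -/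
theorem Rank3Row.minCertified_of_mem_minCerts {i : ℕ} {c : RNCert} (hm : (i, c) ∈ rank3MinCerts) :
    ∃ hi : i < rank3Table.length, (rank3Table[i]'hi).MinCertified :=
  Rank3Row.minCertified_of_posCheck rank3Table_minPosCheck hm

/-- **Cremona's equation of each of the `1420` listed rows is a global minimal model** — no hypothesis.
[cite: SilvermanAEC2009, VII.1 Remark 1.1] -/
theorem Rank3Row.isGloballyMinimal_of_mem_minCerts {i : ℕ} {c : RNCert} (hm : (i, c) ∈ rank3MinCerts) :
    ∃ hi : i < rank3Table.length, (rank3Table[i]'hi).curve.IsGloballyMinimal := by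
  obtain ⟨hi, h⟩ := Rank3Row.minCertified_of_mem_minCerts hm
  exact ⟨hi, Rank3Row.isGloballyMinimal_of_minCertified h⟩

/-- Row `30` (`27747c1`, additive at `3`) is listed: its equation is globally minimal (kernel membership).
[cite: CremonaAlgorithms1997, Tables] -/
theorem isGloballyMinimal_row30 :
    ∃ hi : 30 < rank3Table.length, (rank3Table[30]'hi).curve.IsGloballyMinimal :=
  Rank3Row.isGloballyMinimal_of_mem_minCerts (c := ⟨0, 4, 3, [⟨3, 1, 8, 2, 2⟩, ⟨3083, 55, 1, 0, 0⟩]⟩)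
    (by decide +kernel)

end Summit.BirchSwinnertonDyer.BirchSwinnertonDyer.Rank2Observatory
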